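import Summits.BirchSwinnertonDyer.BirchSwinnertonDyer.Theorems.ByReductionTypeAtTwoRankOneAtTwoOneDoorLawSubsliceDefs
import HarnessLib

/-!
# Route ByReductionTypeAtTwo, crux `RankOneAtTwoBigImageOddLocal` (stmt-BirchSwinnertonDyer-23715), LINE `one_door_analytic` (v8.17 candidate):
# the FOUR MECHANISM STATEMENTS with FLOATING parametrisation constant — R⁻_float, R⁺_float, R_S, R_N — NAMED

Width prover seat `bsd-line-fkl-p2` g14 (2026-08-28).  Companion of `…OneDoorLawSubsliceDefs.lean` (lead g15, APPEND #8–#11: `HasBottomRungDoorAtTwo`,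
`HasLawfulDoorAtTwo`, the residue, R⁻₀, R₊, R₊₊) as a separate module (the statements file is at its size limit).  Statements + import-free bookkeeping
only; NOTHING IS ASSERTED; BSD is not proved by any of this.

Why.  R⁻₀ (`HeegnerNonDivisibilityAtSelmerTrivialPrimeDoorAtTwo`) and the R₊/R₊₊ splits quantify over parametrisation data with ODD constant and so leave a
third population «no odd-constant datum» (the `2`-primary Manin question at `4 ∣ N`) in the residue.  But the door identity
`2m + [Δ_W<0] = s_W + s_d + t + 2s + 2·v₂(c)` is datum-covariant: at a `Sel₂`-trivial transposition prime door of a `Δ_W < 0`, `Ш(W)[2] = 0` curve it reads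
`m = v₂(c)`, and at a `Sel₂`-trivial archimedean door of an egg curve likewise, for EVERY datum.  With the exponent FLOATING with `v₂(c)` the width seat's
`Theorems/…OneDoorSubsliceNegDiscFloat.lean` / `…OneDoorSubslicePosDiscFloat.lean` prove: R⁻_float ⟹ `BSD₂` on ALL of {`Δ_W < 0`, `Ш[2] = 0`} ∩ slice and
R⁺_float ⟹ `BSD₂` on ALL of the egg class (datum by modularity alone), and `rankOneAtTwoBigImageOddLocal_of_floats_of_sha_of_nonEgg`: PRINT⁵ + rank-`0` cruxes
+ R⁻_float + R⁺_float + R_S + R_N ⟹ the crux BY NAME, with the LOSSLESS TABLE crux ⟺ the four modulo PRINT⁵ + rank-`0` + the rank-`0` `2`-converse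
(`rankOneAtTwoBigImageOddLocal_iff_floats_sha_nonEgg_of_twoConverse`).  This file NAMES the four statements (bodies VERBATIM the hypotheses `hRf`, `hPf`, `hS`,
`hN` of those theorems) so that a skeleton v8.17 can register them as stubs; no Manin / `S_manin` statement is needed anywhere.

References (locators): Gross–Zagier 1986 Thm. I.6.3 and V.§2; Gross 1991 Conj. 1.2, §3 and §10; Kolyvagin 1990 Thm. A; Kramer 1981 Prop. 6;
Mazur–Rubin 2010 Prop. 3.3, Cor. 3.4 (i); W. Zhang 2014 Thm. 1.1 (shape, `p ≥ 5`).
-/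

set_option autoImplicit false

noncomputable section

open scoped Classical

set_option linter.dupNamespace false

namespace Summit.BirchSwinnertonDyer.BirchSwinnertonDyer.Theorems.RankOneAtTwoOneDoor

open Literature.NumberTheory.EllipticCurves Literature.NumberTheory.EllipticCurves.ModularForms
  Summit.BirchSwinnertonDyer.Rank1Residual.F1Sign2
  Summit.BirchSwinnertonDyer.Rank1Residual.F1Sign2.TranspositionDoor

/-- **R⁻_float `HeegnerExponentFloatNegDiscAtTwo` — KOLYVAGIN'S CONJECTURE AT `2` WITH FLOATING EXPONENT AT A `Sel₂`-TRIVIAL TRANSPOSITION PRIME DOOR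
(CONJECTURE; candidate stub of LINE v8.17).**  `W/ℚ` globally minimal, non-CM, `ρ_{W,2^n}` onto for all `n`, odd torsion order, odd Tamagawa product, analytic
rank `1`, `Δ_W < 0`, `Ш(W)[2] = 0`; `K` imaginary quadratic and `q₀` prime with `(d_K, q₀)` transposition-admissible and `#Sel₂(W^{(d_K)}) = 1`; `Dt` a
parametrisation datum of level `N_W` of ANY constant `c`, `H`, `ι`, `P ∈ E(K)` over the complex Heegner point.  THEN the exact `2`-divisibility exponent of `P`
modulo torsion is `v₂(c)` (`HasTwoDivisibilityUpToTorsion W K P (v₂ c)`).  For odd `c` this is R⁻₀ (`heegnerNonDivisibility_of_heegnerExponentFloatNegDisc`);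
the point is that NO odd-constant datum is required: R⁻_float gives `BSD₂` on all of {`Δ_W < 0`, `Ш[2] = 0`} ∩ slice (`bsdp_two_of_negDiscFloat`), and
conversely follows from `BSD₂` there modulo the rank-`0` `2`-converse (`negDiscFloat_of_rankOneAtTwoBigImageOddLocal_of_twoConverse`).  Why it might fail: it is
Kolyvagin's conjecture at the prime `2` (Zhang's proof needs `p ≥ 5`).  Census: AN-28c ENGINE L rows at `Δ < 0` with `s_W = s_d = 0` read `m = v₂(c)`
(812/812 at odd `c`). [cite: Zhang2014CJM, Thm. 1.1 (p ≥ 5; shape only)] [cite: GrossLMS1991, Conj. 1.2, §3 and §10] [cite: MazurRubin2010, Cor. 3.4 (i)] -/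
@[conjecture] def HeegnerExponentFloatNegDiscAtTwo : Prop :=
  ∀ (W : WeierstrassCurve ℚ) [W.IsElliptic] [W.IsGloballyMinimal] [NeZero (W.conductorNorm ℤ)],
    ¬ W.HasCM → (∀ n : ℕ, W.HasSurjectiveModNGaloisRep ((2 ^ n : ℕ) : ℤ)) → Odd W.torsionOrder → Odd W.tamagawaProduct →
    W.analyticRank = 1 → W.Δ < 0 → ShaTwoTrivial W →
    ∀ (K : Type) [Field K] [NumberField K], IsImaginaryQuadratic K →
      ∀ (q₀ : ℕ) [Fact q₀.Prime], TranspAdmissible W (NumberField.discr K) q₀ → twistSelmerTwoCard W (NumberField.discr K) = 1 →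
        ∀ (Dt : ModularParametrizationData W (W.conductorNorm ℤ)) (H : HeegnerDatum (W.conductorNorm ℤ) (NumberField.discr K)) (ι : K →+* ℂ)
          (P : (W.baseChange K).toAffine.Point),
          WeierstrassCurve.Affine.Point.map ι.toRatAlgHom P = heegnerPointComplex Dt H →
          HasTwoDivisibilityUpToTorsion W K P (padicValInt 2 Dt.c)

/-- **R⁺_float `HeegnerExponentFloatEggAtTwo` — THE SAME AT A `Sel₂`-TRIVIAL ARCHIMEDEAN DOOR OF AN EGG CURVE (CONJECTURE; candidate stub of LINE v8.17;
the floating-exponent form of -an's AN-13 `HeegnerPointOnEggAtTwo`).**  `W` as above with `Δ_W > 0`, `Ш(W)[2] = 0`, `E(ℚ)` meeting the egg; `K` imaginary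
quadratic with `d_K` DESC-admissible and `#Sel₂(W^{(d_K)}) = 1` (automatic for egg curves by T-C `eggTwistLawAtTwo_holds`; such `K` exist by
`GenusKolyTwin.exists_silent_prime_heegnerField`); ANY datum `Dt`, `H`, `ι`, `P` over the complex Heegner point.  THEN the exponent of `P` is `v₂(c)`.
Gives `BSD₂` on all of the egg class (`bsdp_two_of_posDiscFloat`), conversely from `BSD₂` modulo the rank-`0` `2`-converse.  Why it might fail: Kolyvagin's
conjecture at `2`.  Census: AN-28c ENGINE L rows at `Δ > 0`, egg bit `1`, `s_W = s_d = 0`: `m = v₂(c)`; -an ENGINE HC/IX (cusp bit = κ·[I odd], 434/434).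
[cite: Zhang2014CJM, Thm. 1.1 (p ≥ 5; shape only)] [cite: Kramer1981, Prop. 6] [cite: GrossLMS1991, Conj. 1.2 and §10] -/
@[conjecture] def HeegnerExponentFloatEggAtTwo : Prop :=
  ∀ (W : WeierstrassCurve ℚ) [W.IsElliptic] [W.IsGloballyMinimal] [NeZero (W.conductorNorm ℤ)],
    ¬ W.HasCM → (∀ n : ℕ, W.HasSurjectiveModNGaloisRep ((2 ^ n : ℕ) : ℤ)) → Odd W.torsionOrder → Odd W.tamagawaProduct →
    W.analyticRank = 1 → 0 < W.Δ → ShaTwoTrivial W → MeetsEgg W →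
    ∀ (K : Type) [Field K] [NumberField K], IsImaginaryQuadratic K →
      DescAdmissible W (NumberField.discr K) → twistSelmerTwoCard W (NumberField.discr K) = 1 →
        ∀ (Dt : ModularParametrizationData W (W.conductorNorm ℤ)) (H : HeegnerDatum (W.conductorNorm ℤ) (NumberField.discr K)) (ι : K →+* ℂ)
          (P : (W.baseChange K).toAffine.Point),
          WeierstrassCurve.Affine.Point.map ι.toRatAlgHom P = heegnerPointComplex Dt H →
          HasTwoDivisibilityUpToTorsion W K P (padicValInt 2 Dt.c)

/-- **R_S `LawfulDoorOfShaTwoNontrivialAtTwo` — A LAWFUL DOOR FOR THE CURVES OF THE SLICE WITH `Ш(W)[2] ≠ 0` (CONJECTURE; candidate stub of LINE v8.17;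
the «24882-type» population: Kolyvagin exactness at `2` beyond the first layer).**  For `W` of the slice (globally minimal, non-CM, `ρ_{W,2^n}` onto, odd torsion
order, odd Tamagawa product, analytic rank `1`) with `Ш(W)[2] ≠ 0`: SOME non-vanishing admissible door datum and exponent `m` at which
`2m + [Δ_W<0] = ord₂ #Ш(W)[2^∞] + ord₂ #Ш(Wd)[2^∞] + t + 2s + 2·v₂(c)` (`HasLawfulDoorAtTwo W`).  On this population `¬ HasBottomRungDoorAtTwo W` is automatic
modulo print (`not_hasBottomRungDoorAtTwo_of_not_shaTwoTrivial`) and every exponent at a minimal odd-constant door is positive.  Equivalent to `BSDp W 2` there modulo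
print + rank-`0` (`bsdp_two_of_hasLawfulDoorAtTwo`, `hasLawfulDoorAtTwo_of_bsdp_two`).  Why it might fail: the `2`-part of BSD for rank-one curves with
`Ш[2] ≠ 0` — Kolyvagin's higher `2`-layers (route GenusKolyvaginAtTwo's 24882/24883; -desc §27 transport `Ш(W)[2] ≅ Sel₂(W^d)` at archimedean doors).
Census: AN-28c rows with `s_W > 0`. [cite: GrossLMS1991, Conj. 1.2, §3 and §10] [cite: Kolyvagin1990, Thm. A] -/
@[conjecture] def LawfulDoorOfShaTwoNontrivialAtTwo : Prop :=
  ∀ (W : WeierstrassCurve ℚ) [W.IsElliptic] [W.IsGloballyMinimal] [NeZero (W.conductorNorm ℤ)],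
    ¬ W.HasCM → (∀ n : ℕ, W.HasSurjectiveModNGaloisRep ((2 ^ n : ℕ) : ℤ)) → Odd W.torsionOrder → Odd W.tamagawaProduct →
    W.analyticRank = 1 → ¬ ShaTwoTrivial W → HasLawfulDoorAtTwo W

/-- **R_N `LawfulDoorOfPosDiscNonEggAtTwo` — A LAWFUL DOOR FOR THE `Δ_W > 0` NON-EGG CURVES OF THE SLICE WITH `Ш(W)[2] = 0` (CONJECTURE; candidate stub of
LINE v8.17; the «24883-type» / `η_f = 0` population).**  For `W` of the slice with `Δ_W > 0`, `Ш(W)[2] = 0` and `E(ℚ) ⊂ E⁰(ℝ)` (`¬ MeetsEgg W`):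
`HasLawfulDoorAtTwo W`.  Here every desc-admissible twist has `#Sel₂(W^{(d)}) = 4` (T-C), so at a non-vanishing archimedean door `s_d ≥ 2` and `m ≥ 1`
(`exponent_pos_of_not_meetsEgg`); `¬ HasBottomRungDoorAtTwo W` is automatic modulo print (`not_hasBottomRungDoorAtTwo_of_not_meetsEgg`).  Equivalent to `BSDp W 2`
there modulo print + rank-`0`.  Why it might fail: the `2`-part of BSD on the non-egg locus (no first-layer Kolyvagin class is non-zero at any minimal door).
Census: AN-28c rows at `Δ > 0` with egg bit `0`; -an ENGINE E/HC. [cite: GrossLMS1991, Conj. 1.2, §3 and §10] [cite: Kramer1981, Prop. 6] [cite: Kolyvagin1990, Thm. A] -/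
@[conjecture] def LawfulDoorOfPosDiscNonEggAtTwo : Prop :=
  ∀ (W : WeierstrassCurve ℚ) [W.IsElliptic] [W.IsGloballyMinimal] [NeZero (W.conductorNorm ℤ)],
    ¬ W.HasCM → (∀ n : ℕ, W.HasSurjectiveModNGaloisRep ((2 ^ n : ℕ) : ℤ)) → Odd W.torsionOrder → Odd W.tamagawaProduct →
    W.analyticRank = 1 → 0 < W.Δ → ShaTwoTrivial W → ¬ MeetsEgg W → HasLawfulDoorAtTwo W

/-! ### Import-free bookkeeping -/

/-- **R⁻_float ⟹ R⁻₀** (an odd constant has `v₂(c) = 0`; R⁻₀'s extra door hypotheses are simply dropped). [cite: GrossLMS1991, §10] -/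
theorem heegnerNonDivisibility_of_heegnerExponentFloatNegDisc (h : HeegnerExponentFloatNegDiscAtTwo) :
    HeegnerNonDivisibilityAtSelmerTrivialPrimeDoorAtTwo := by
  intro W _ _ _ hCM hsurj hT hc hr hΔ hSha K _ _ hK q₀ _ htr _ _ _ hsel Dt H ι P hP hodd
  have hc2 : ¬ (2 : ℤ) ∣ Dt.c := fun h2 => Int.not_even_iff_odd.mpr hodd (even_iff_two_dvd.mpr h2)
  have h0 : padicValInt 2 Dt.c = 0 := padicValInt.eq_zero_of_not_dvd hc2
  have h' := h W hCM hsurj hT hc hr hΔ hSha K hK q₀ htr hsel Dt H ι P hP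
  rwa [h0] at h'

/-- **The hypothesis-free residue ⟹ R_S and R_N** (drop hypotheses): both populations are instances of `DoorIndexLawFullCAtTwoSomeDoor`.
[cite: GrossLMS1991, Conj. 1.2 and §3] -/
theorem lawfulDoor_populations_of_someDoor (h : DoorIndexLawFullCAtTwoSomeDoor) :
    LawfulDoorOfShaTwoNontrivialAtTwo ∧ LawfulDoorOfPosDiscNonEggAtTwo :=
  ⟨fun W _ _ _ hCM hsurj hT hc hr _ => h W hCM hsurj hT hc hr, fun W _ _ _ hCM hsurj hT hc hr _ _ _ => h W hCM hsurj hT hc hr⟩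

/-- **R_S ∧ R_N give the residue OFF {`Ш(W)[2] = 0` ∧ (`Δ_W < 0` ∨ `MeetsEgg`)}** — the `hrest` input of the width seat's Manin-free composition
`doorIndexLawFullCAtTwoSomeDoorOffSubslice_of_floats_of_rest` (import-free case analysis on `Δ_W ≠ 0`; NO third population). [cite: GrossLMS1991, Conj. 1.2 and §10] -/
theorem rest_of_lawfulDoor_populations (hS : LawfulDoorOfShaTwoNontrivialAtTwo) (hN : LawfulDoorOfPosDiscNonEggAtTwo) :
    ∀ (W : WeierstrassCurve ℚ) [W.IsElliptic] [W.IsGloballyMinimal] [NeZero (W.conductorNorm ℤ)],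
      ¬ W.HasCM → (∀ n : ℕ, W.HasSurjectiveModNGaloisRep ((2 ^ n : ℕ) : ℤ)) → Odd W.torsionOrder → Odd W.tamagawaProduct →
      W.analyticRank = 1 → ¬ HasBottomRungDoorAtTwo W → ¬ (ShaTwoTrivial W ∧ (W.Δ < 0 ∨ MeetsEgg W)) → HasLawfulDoorAtTwo W := by
  intro W _ _ _ hCM hsurj hT hc hr _ hcls
  by_cases hSha : ShaTwoTrivial W
  · rcases lt_or_gt_of_ne W.isUnit_Δ.ne_zero with hΔ | hΔ
    · exact absurd ⟨hSha, Or.inl hΔ⟩ hcls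
    · exact hN W hCM hsurj hT hc hr hΔ hSha (fun hme => hcls ⟨hSha, Or.inr hme⟩)
  · exact hS W hCM hsurj hT hc hr hSha

end Summit.BirchSwinnertonDyer.BirchSwinnertonDyer.Theorems.RankOneAtTwoOneDoor

end
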